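import Mathlib
import HarnessLib
import Summits.ValiantsHypothesis.ValiantsHypothesis.Theses.MonotoneRestoration
import Literature.Computability.AlgebraicComplexity.SymmetricCircuitSubstitution
import Literature.Computability.AlgebraicComplexity.SymmetricCircuitPairing
import Literature.Computability.AlgebraicComplexity.SymmetricCircuitConstOutputs
import Literature.Computability.AlgebraicComplexity.SymmetricCircuitHadamard
import Literature.Computability.AlgebraicComplexity.SymmetricDetCircuitEval
import Summits.ValiantsHypothesis.ValiantsHypothesis.Theorems.MonotoneRestorationMonotoneRestorationQPZetaHomogeneous
import Summits.ValiantsHypothesis.ValiantsHypothesis.Theorems.MonotoneRestorationMonotoneRestorationQPZetaPatterns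

/-! # Route MonotoneRestoration — crux `MonotoneRestorationQP`, line Sketch v10: THEOREM ζ-C
(stmt-ValiantsHypothesis-15886, lead c5)

**All characteristic coefficients of equivariant matrix circuits restore** (hence every spectral
invariant: `e_k` of the eigenvalues, power sums `tr Mᵏ` by Newton, discriminants, …).
Part of THEOREM ζ (the SIZE CALCULUS of Dawar–Wilsenach square-symmetric circuits). Le Verrier's
symmetric circuit (`symLeVerrierCircuit`, Dawar–Wilsenach Thm 4.1 in the tree) has, besides its
output `c_0 = det X`, a gate `coef l` for EVERY coefficient `c_l` of the characteristic polynomial of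
`−X`, and these gates are fixed by the symmetric group; re-targeting the output to such a gate keeps
the circuit symmetric (`zeta_symmetric_retarget`). Substituting the negated equivariant family `−M`
(constants Z8, pairing, Hadamard Z4) by Z1 then yields `charpoly(M).coeff l`.

* `zeta_symmetric_retarget` — a bundled symmetric circuit with its output moved to any gate fixed
  by the action is symmetric;
* `zeta_symmetric_charpolyCoeff_generic` — `charpoly(−X).coeff l` on `(n+2)⁴` gates;
* `zeta_symmetric_neg_family` — `−M` on `|G| + 3n²` gates;
* `zeta_symmetric_charpolyCoeff` — `charpoly(M).coeff l` on `|G| + 3n² + (n+2)⁴` gates;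
* `qpSymmetric_charpolyCoeff` — COROLLARY AT THE CRUX'S SCALE (registered).
-/

noncomputable section

-- `Summit.ValiantsHypothesis.ValiantsHypothesis.…` is the tree's mandated namespace (Sub = Summit).
set_option linter.dupNamespace false

namespace Summit.ValiantsHypothesis.ValiantsHypothesis.Theorems

open Literature.Computability.AlgebraicComplexity

/-! ### Re-targeting the output of a bundled symmetric circuit -/

/-- **Re-targeting.** If `Γ` acts on the gates of a circuit by automorphisms (a bundled
`SymmetricArithmeticCircuit`) and the gate `g₀` is fixed by the action, then the same circuit with
its single output moved to `g₀` is `Γ`-symmetric (for any action on `Unit`) and computes the value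
of `g₀`. [folklore] -/
theorem zeta_symmetric_retarget {K X Y G Γ : Type} [CommSemiring K] [Group Γ] [MulAction Γ X]
    [MulAction Γ Y] [MulAction Γ G] [MulAction Γ Unit] (C : SymmetricArithmeticCircuit Γ K X Y G)
    (g₀ : G) (hg₀ : ∀ γ : Γ, γ • g₀ = g₀) :
    ∃ C' : LabelledArithCircuit K X Unit G,
      C'.IsSymmetric Γ ∧ C'.eval (C'.output ()) = C.eval g₀ := by
  let out : Unit → G := fun _ => g₀
  have hout : Function.Injective out := fun _ _ _ => rfl
  refine ⟨{ C.toLabelledArithCircuit with output := out, output_injective := hout },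
    fun γ => ?_, rfl⟩
  exact ⟨MulAction.toPerm γ, ⟨C.children_smul γ, C.label_smul γ, fun _ => (hg₀ γ).symm⟩⟩

/-! ### Characteristic coefficients of the generic matrix -/

/-- **ζ-C1 — characteristic coefficients of the generic matrix.** Over a field of characteristic
`0`, for every `l < n` the coefficient of `t^l` in the characteristic polynomial of `−X`
(`X = (x_ij)` the generic matrix; `charpoly(−X)(t) = det(t·1 + X)`, so this is the sum of the
principal `(n − l)`-minors of `X`) is computed by a square-symmetric circuit on at most `(n+2)⁴`
gates: Le Verrier's circuit re-targeted to its gate `coef l`. [cite: DawarWilsenach2025, Thm. 4.1] -/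
theorem zeta_symmetric_charpolyCoeff_generic (K : Type) [Field K] [CharZero K] {n : ℕ}
    [MulAction (Equiv.Perm (Fin n)) Unit] (l : Fin n) :
    ∃ (G : Type) (_ : Fintype G) (C : LabelledArithCircuit K (Fin n × Fin n) Unit G),
      C.IsSymmetric (Equiv.Perm (Fin n)) ∧
      C.eval (C.output ()) = (leVerrierMatrix K n).charpoly.coeff l ∧
      Fintype.card G ≤ (n + 2) ^ 4 := by
  obtain ⟨C', h', hev'⟩ := zeta_symmetric_retarget (symLeVerrierCircuit K n)
    (LeVerrierGate.coef l) (fun σ => rfl)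
  refine ⟨LeVerrierGate n, inferInstance, C', h', ?_, card_leVerrierGate_le n⟩
  rw [hev']
  exact leVerrierCircuit.eval_coef_of K l (leVerrierCircuit.eval_nmat K l)

/-! ### Negating an equivariant family -/

/-- **Negation of an equivariant matrix family** on `|G| + 3n²` gates (pair with the invariant
constant family `−1`, Z8, and multiply entrywise, Z4). [folklore] -/
theorem zeta_symmetric_neg_family {K X G : Type} [CommRing K] {n : ℕ}
    [MulAction (Equiv.Perm (Fin n)) X] [Fintype G]
    (C : LabelledArithCircuit K X (Fin n × Fin n) G) (hC : C.IsSymmetric (Equiv.Perm (Fin n))) :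
    ∃ (G' : Type) (_ : Fintype G') (C' : LabelledArithCircuit K X (Fin n × Fin n) G'),
      C'.IsSymmetric (Equiv.Perm (Fin n)) ∧
      (∀ i j, C'.eval (C'.output (i, j)) = -C.eval (C.output (i, j))) ∧
      Fintype.card G' ≤ Fintype.card G + 3 * (n * n) := by
  obtain ⟨G₁, i₁, C₁, h₁, hev₁, hc₁⟩ := LabelledArithCircuit.exists_constOutputs (K := K) X
    (Γ := Equiv.Perm (Fin n)) (fun _ : Fin n × Fin n => (-1 : K)) (fun _ _ => rfl)
  obtain ⟨G₀, i₀, C₀, h₀, hinl, hinr, hc₀⟩ := hC.exists_pairing h₁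
  obtain ⟨G', i', C', h', hev', hc'⟩ := h₀.exists_hadamard
  refine ⟨G', i', C', h', fun i j => ?_, ?_⟩
  · rw [hev', hinl, hinr, hev₁, map_neg, map_one, mul_neg_one]
  · have hX : Fintype.card (Fin n × Fin n) = n * n := by simp
    rw [hX] at hc' hc₁
    omega

/-! ### THEOREM ζ-C -/

/-- **THEOREM ζ-C — CHARACTERISTIC COEFFICIENTS OF EQUIVARIANT MATRIX CIRCUITS.** Over a field of
characteristic `0`: if an equivariant matrix `M` is computed by a square-symmetric circuit on `|G|`
gates, then for every `l < n` the coefficient `charpoly(M).coeff l` is computed by a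
square-symmetric single-output circuit on at most `|G| + 3n² + (n+2)⁴` gates (ζ-C1 after the negated
family, by substitution Z1: `charpoly(−(−M)) = charpoly(M)` through `Matrix.charpoly_map`).
[folklore] -/
theorem zeta_symmetric_charpolyCoeff {K X G : Type} [Field K] [CharZero K] {n : ℕ}
    [MulAction (Equiv.Perm (Fin n)) X] [MulAction (Equiv.Perm (Fin n)) Unit] [Fintype G]
    (C : LabelledArithCircuit K X (Fin n × Fin n) G) (hC : C.IsSymmetric (Equiv.Perm (Fin n)))
    (l : Fin n) :
    ∃ (G' : Type) (_ : Fintype G') (C' : LabelledArithCircuit K X Unit G'),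
      C'.IsSymmetric (Equiv.Perm (Fin n)) ∧
      C'.eval (C'.output ()) = (Matrix.of fun i j => C.eval (C.output (i, j))).charpoly.coeff l ∧
      Fintype.card G' ≤ Fintype.card G + 3 * (n * n) + (n + 2) ^ 4 := by
  obtain ⟨Gn, inn, Cn, hn, hevn, hcn⟩ := zeta_symmetric_neg_family C hC
  obtain ⟨G₂, i₂, C₂, h₂, hev₂, hc₂⟩ := zeta_symmetric_charpolyCoeff_generic K l
  obtain ⟨G', i', C', h', hev', hc'⟩ := hn.exists_substitution h₂
  refine ⟨G', i', C', h', ?_, hc'.trans (by omega)⟩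
  rw [hev' (), hev₂]
  set f : MvPolynomial (Fin n × Fin n) K →ₐ[K] MvPolynomial X K :=
    MvPolynomial.aeval fun x' => Cn.eval (Cn.output x') with hf
  have hM : (leVerrierMatrix K n).map (f : MvPolynomial (Fin n × Fin n) K →+* MvPolynomial X K) =
      Matrix.of fun i j => C.eval (C.output (i, j)) := by
    refine Matrix.ext fun a b => ?_
    rw [Matrix.map_apply, AlgHom.coe_toRingHom, leVerrierMatrix_apply, map_neg, hf,
      MvPolynomial.aeval_X, Matrix.of_apply, hevn, neg_neg]
  have h1 : f ((leVerrierMatrix K n).charpoly.coeff l) =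
      (((leVerrierMatrix K n).charpoly).map
        (f : MvPolynomial (Fin n × Fin n) K →+* MvPolynomial X K)).coeff l := by
    rw [Polynomial.coeff_map, AlgHom.coe_toRingHom]
  rw [h1, ← Matrix.charpoly_map, hM]

/-! ### The corollary at the crux's scale -/

/-- Quasi-polynomial bookkeeping for ζ-C. [folklore] -/
theorem zeta_qp_charpoly_le (c : ℕ) : ∃ c' : ℕ, ∀ n : ℕ,
    2 ^ ((Nat.log 2 n + c) ^ c) + 3 * (n * n) + (n + 2) ^ 4 ≤ 2 ^ ((Nat.log 2 n + c') ^ c') := by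
  obtain ⟨c', hc'⟩ := zeta_poly_mul_qp_le 5 4 c 1
  refine ⟨c', fun n => le_trans ?_ (hc' n)⟩
  set Q := 2 ^ ((Nat.log 2 n + c) ^ c) with hQ
  have hQ1 : 1 ≤ Q := Nat.one_le_two_pow
  rw [one_mul]
  have h2 : n * n ≤ (n + 2) ^ 4 := by nlinarith
  have h4 : 1 ≤ (n + 2) ^ 4 := Nat.one_le_pow _ _ (by omega)
  nlinarith

/-- **COROLLARY ζ-C (crux scale) — CHARACTERISTIC COEFFICIENTS OF EQUIVARIANT MATRIX CIRCUITS
RESTORE AT QUASI-POLYNOMIAL COST.** If `(M_n)` is a family of equivariant `n × n` matrices over `ℂ`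
computed by square-symmetric circuits of quasi-polynomial size, then for any choice of indices
`l_n` the family `charpoly(M_n).coeff l_n` has square-symmetric single-output circuits of
quasi-polynomial size (for `l_n ≥ n` the coefficient is the constant `[l_n = n]`). With Newton's
identities / ζ-G this covers every spectral invariant of an equivariantly built matrix — the
coherent-algebra exclusion of the census as a theorem. [folklore] -/
theorem qpSymmetric_charpolyCoeff :
    ∀ (M : (n : ℕ) → Matrix (Fin n) (Fin n) (MvPolynomial (Fin n × Fin n) ℂ)) (l : ℕ → ℕ),
      (∃ c : ℕ, ∀ n : ℕ, ∃ (G : Type) (_ : Fintype G)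
        (C : LabelledArithCircuit ℂ (Fin n × Fin n) (Fin n × Fin n) G),
        C.IsSymmetric (Equiv.Perm (Fin n)) ∧ (∀ i j, C.eval (C.output (i, j)) = M n i j) ∧
          Fintype.card G ≤ 2 ^ ((Nat.log 2 n + c) ^ c)) →
      ∃ c : ℕ, ∀ n : ℕ, ∃ (G : Type) (_ : Fintype G)
        (C : LabelledArithCircuit ℂ (Fin n × Fin n) Unit G),
        C.IsSymmetric (Equiv.Perm (Fin n)) ∧
          C.eval (C.output ()) = (M n).charpoly.coeff (l n) ∧
          Fintype.card G ≤ 2 ^ ((Nat.log 2 n + c) ^ c) := by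
  intro M l hM
  obtain ⟨c, hc⟩ := hM
  obtain ⟨c', hc'⟩ := zeta_qp_charpoly_le c
  refine ⟨c', fun n => ?_⟩
  obtain ⟨G, inst, C, hsym, hev, hcard⟩ := hc n
  have hMof : (Matrix.of fun i j => C.eval (C.output (i, j))) = M n :=
    Matrix.ext fun i j => hev i j
  by_cases hl : l n < n
  · obtain ⟨G', i', C', h', hev', hcG⟩ := zeta_symmetric_charpolyCoeff C hsym ⟨l n, hl⟩
    refine ⟨G', i', C', h', by rw [hev', hMof], (hcG.trans ?_).trans (hc' n)⟩
    omega
  · -- beyond the degree: the coefficient is the constant `[l n = n]` (monic of degree `n`)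
    have hdeg : (M n).charpoly.natDegree = n := by
      rw [Matrix.charpoly_natDegree_eq_dim, Fintype.card_fin]
    have hcoef : (M n).charpoly.coeff (l n) = if l n = n then 1 else 0 := by
      by_cases he : l n = n
      · rw [if_pos he, he]
        have hmon := (Matrix.charpoly_monic (M n)).coeff_natDegree
        rwa [hdeg] at hmon
      · rw [if_neg he]
        exact Polynomial.coeff_eq_zero_of_natDegree_lt (by rw [hdeg]; omega)
    obtain ⟨G', i', C', h', hev', hcG⟩ := zeta_symmetric_constant (X := Fin n × Fin n)
      (Γ := Equiv.Perm (Fin n)) (if l n = n then (1 : ℂ) else 0)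
    refine ⟨G', i', C', h', ?_, hcG.trans Nat.one_le_two_pow⟩
    rw [hev', hcoef]
    split_ifs <;> simp

end Summit.ValiantsHypothesis.ValiantsHypothesis.Theorems

end
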